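import Summits.QuantumFields.YangMills.Theorems.BalabanUVNodesN09FibreThresholdNullAE
import Literature.MathematicalPhysics.QuantumFieldTheory.Balaban1983to89.Node00.CanonicalTransportOfRecord

/-!
# NODE N09 · THE β-TRANSPORT OF RECORD `TcanOfRecord` AND ITS MAXIMAL REGULAR SET DO NOT SEE HOW A DENSITY IS CUT AT THE SMALL-FIELD THRESHOLD:
# `regSetOfRecord K k (chiFixAltOfRecord·ρ) = regSetOfRecord K k (𝟙_{closure domAlt_k}·ρ)` and the two canonical versions agree at EVERY point of it (sequel to
# `…N09FibreThresholdNullAE`, read through K0e's canonical-version transport)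

Cell `pub-ymgap` (YM-PLAN Track A), DAG node N09 [Balaban1987RG1] (= [I]); seat `pub-ymgap-dag-n09-w1` g4; count-neutral helper keyed to K1⁷
`stmt-QuantumFields-20542` (`--kind proof --supports … --as helper`).  HONEST FRAMING: kernel bookkeeping at NODE 00's definitions; NOTHING of Bałaban's analysis
asserted; N09 NOT discharged; K0⁷∕K1⁷ NOT closed; counts unmoved; one finite 𝕋⁴ programme at fixed ε — R4 closes the conditional rung `BalabanLadder.UV` only; the
Yang–Mills mass gap (Clay) is NOT proved by any of this; nothing continuum ∕ ℝ⁴ ∕ OS.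

WHY.  N09's analytic binder `hreg : domAltOfRecord ν K (j+1) ⊆ regSetOfRecord K j ρ_j` (n09-w3 g2 memo §2 item 4) reads the MAXIMAL REGULAR SET of the transform of record
(K0e `Node00/CanonicalTransportOfRecord`: the largest open set on which the transform's a.e.-class has a continuous version; the β token of Record 13 is the canonical
version `TcanOfRecord`, director-ym №128 D2 (i′)).  The sibling file showed that the transform of record of `chiFixAltOfRecord·ρ` (SHARP cut at `|V(∂p) − 1| < ε₀`) and of
`𝟙_{closure domAlt_k}·ρ` (CLOSED-class cut) are `dV`-a.e. EQUAL (`transportOfRecord_chiFixAlt_mul_ae_eq_closure_indicator_mul`, (F2) on the fibres a.e.).  Since `regSet` and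
the canonical version on it are invariants of the a.e.-class (K0e `regSet_congr_ae`, `canonVersion_eqOn_congr_ae` — product Haar charges open sets, def-T
`isOpenPosMeasure_piHaar_SUN`), the set `hreg` speaks about, and the β-transport on it, are the SAME for both cut-off conventions: whatever (F1) will prove about the regular
set is convention-independent at the threshold.

WHAT IS PROVED (theorems only; 0 def; 0 sorry; axioms standard).  `F : T4Family`, `N` with `[NeZero N]`, `ν` with `ν.ε₀ ≠ 0`, `K k : ℕ`, `ρ` any step-`k` density.
★★ `regSetOfRecord_chiFixAlt_mul_eq_closure_indicator_mul`, ★★ `TcanOfRecord_chiFixAlt_mul_eqOn_regSet` (EVERY point of the regular set),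
`TcanOfRecord_chiFixAlt_mul_ae_eq_closure_indicator_mul` (`dV`-a.e.).  Elaboration note: `canonVersion_eqOn_congr_ae` is applied with `(α := PBond (F.P K) (k + 1) → SU N)`
explicit (through the unfolding of `TcanOfRecord` the topology metavariable otherwise lands on a term instance search cannot close).

HONEST SCOPE.  Says NOTHING about how large the regular set is (that is (F1)–(F3) everywhere-in-V, located-open); `hreg`∕`contTOn` stay DISPLAYED; nothing of K0e re-proved.
-/

noncomputable section

open MeasureTheory Set Filter Topology
open Literature.MathematicalPhysics.QuantumFieldTheory
open Literature.MathematicalPhysics.QuantumFieldTheory.Balaban1983to89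
open Literature.MathematicalPhysics.QuantumFieldTheory.Balaban1983to89.Node00
open Literature.MathematicalPhysics.QuantumFieldTheory.Balaban1983to89.T4Continuum (T4Family)

namespace Summit.QuantumFields.YangMills.BalabanUVNodes.N09TransportCutoffBlind

variable (F : T4Family) (N : ℕ) [NeZero N]

/-- **★★ THE MAXIMAL REGULAR SET OF THE TRANSFORM OF RECORD DOES NOT SEE THE CUT-OFF CONVENTION**: `regSetOfRecord K k (chiFixAltOfRecord·ρ) =
regSetOfRecord K k (𝟙_{closure domAlt_k}·ρ)` (`ν.ε₀ ≠ 0`; the two transforms are `dV`-a.e. equal by the sibling file, and `regSet` is an a.e.-class invariant —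
K0e `regSet_congr_ae`). [cite: Balaban1987RG1, (0.13) p.254 and p.259] -/
theorem regSetOfRecord_chiFixAlt_mul_eq_closure_indicator_mul (ν : Stage7Numerics) (hε : ν.ε₀ ≠ 0) (K k : ℕ) (ρ : Density (F.P K) k (SU N)) :
    regSetOfRecord F N K k (fun U => chiFixAltOfRecord F N ν K k U * ρ U) =
      regSetOfRecord F N K k (fun U => (closure (domAltOfRecord F N ν K k)).indicator (fun _ => (1 : ℝ)) U * ρ U) :=
  regSet_congr_ae (N09FibreThresholdNullAE.transportOfRecord_chiFixAlt_mul_ae_eq_closure_indicator_mul F N ν hε K k ρ)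

/-- **★★ … AND THE TWO β-TRANSPORTS AGREE AT EVERY POINT OF IT**: `TcanOfRecord K k (χ♯·ρ) = TcanOfRecord K k (χ̄·ρ)` on `regSetOfRecord K k (χ♯·ρ)` (K0e
`canonVersion_eqOn_congr_ae`; product Haar on `SU(N)`-fields charges open sets — def-T `isOpenPosMeasure_piHaar_SUN`). [cite: Balaban1987RG1, (0.13) p.254 and p.259] -/
theorem TcanOfRecord_chiFixAlt_mul_eqOn_regSet (ν : Stage7Numerics) (hε : ν.ε₀ ≠ 0) (K k : ℕ) (ρ : Density (F.P K) k (SU N)) :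
    EqOn (fun V : PBond (F.P K) (k + 1) → SU N => TcanOfRecord F N K k (fun U => chiFixAltOfRecord F N ν K k U * ρ U) V)
      (fun V : PBond (F.P K) (k + 1) → SU N =>
        TcanOfRecord F N K k (fun U => (closure (domAltOfRecord F N ν K k)).indicator (fun _ => (1 : ℝ)) U * ρ U) V)
      (regSetOfRecord F N K k (fun U => chiFixAltOfRecord F N ν K k U * ρ U)) := by
  haveI := isOpenPosMeasure_piHaar_SUN N (F.P K) (k + 1)
  -- read the sibling file's `dV`-a.e. equality over the RAW configuration type `PBond → SU N` (Pi instances; `piHaar = fieldMeasure`, `rfl`)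
  have h : (fun V : PBond (F.P K) (k + 1) → SU N => transportOfRecord F N K k (fun U => chiFixAltOfRecord F N ν K k U * ρ U) V)
      =ᵐ[piHaar (F.P K) (k + 1) (SU N)]
      fun V => transportOfRecord F N K k (fun U => (closure (domAltOfRecord F N ν K k)).indicator (fun _ => (1 : ℝ)) U * ρ U) V :=
    N09FibreThresholdNullAE.transportOfRecord_chiFixAlt_mul_ae_eq_closure_indicator_mul F N ν hε K k ρ
  intro V hV
  exact canonVersion_eqOn_congr_ae (α := PBond (F.P K) (k + 1) → SU N) (μ := piHaar (F.P K) (k + 1) (SU N)) h hV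

/-- … and `dV`-a.e. everywhere. [cite: Balaban1987RG1, (0.13) p.254 (bookkeeping)] -/
theorem TcanOfRecord_chiFixAlt_mul_ae_eq_closure_indicator_mul (ν : Stage7Numerics) (hε : ν.ε₀ ≠ 0) (K k : ℕ) (ρ : Density (F.P K) k (SU N)) :
    (fun V => TcanOfRecord F N K k (fun U => chiFixAltOfRecord F N ν K k U * ρ U) V) =ᵐ[fieldMeasure (F.P K) (k + 1) (SU N)]
      fun V => TcanOfRecord F N K k (fun U => (closure (domAltOfRecord F N ν K k)).indicator (fun _ => (1 : ℝ)) U * ρ U) V :=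
  ((TcanOfRecord_ae_eq K k _).trans (N09FibreThresholdNullAE.transportOfRecord_chiFixAlt_mul_ae_eq_closure_indicator_mul F N ν hε K k ρ)).trans
    (TcanOfRecord_ae_eq K k _).symm

end Summit.QuantumFields.YangMills.BalabanUVNodes.N09TransportCutoffBlind

end
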